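import Literature.NumberTheory.Rogawski1990.ArchTorusOrbitalOneSidedLimitsGlobal   -- ★ LH3-p04 (g2) (C-bdry-glob): brings (C-bdry-ρ), J1's transport, ★ (J-cw), ★ (C-cw)
import Literature.NumberTheory.Rogawski1990.ArchGlobalStableOrbitalWallDeriv        -- ★ (δ) F0P3a-p07: Fubini reduction to one place, `exists_contDiff_partialOrbital_eq`
import HarnessLib

/-!
# (C-cw)∕(J-cw) GLOBAL: `2 sin ψ · ∫_{G′_∞} Θ(↑↑(g·t((z^ψ)∘ρ)·g⁻¹)) dν_∞ → 0` and its `ψ`-derivative has a two-sided limit at a COMPACT wall of one indefinite place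
# (Rogawski 1990 §8.2 p. 123 «−2cF′(γ₀′)»; Varadarajan 1989 §6.4; Borel–Jacquet §4.1)

Topic `NumberTheory/Rogawski1990`; namespace `Literature.NumberTheory.Rogawski1990`.  THEOREMS ONLY (no `def`, no instance, no notation, no axiom, no named fact, no `sorry`).
Cell `pub/hodgecm-mathlib`, line LH3 (closer stub `stub_N9`, crux H413 = `stmt-HodgeConjecture-24833`), organ (M2-01) «the Δ″-side of `a′ ∈ C_c^∞(G′_∞)` extends continuously with
its first derivative across a `G`-wall» (LH3-plan (g2) 05:33∕05:36Z), brick A: the COMPACT-WALL companion of ★ (C-bdry-glob) `ArchTorusOrbitalOneSidedLimitsGlobal` — same setting and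
bookkeeping, with ★ (C-cw) `continuousAt_integral_comp_conj_circleDiagonal_compactWall` and ★ (J-cw) `tendsto_deriv_sin_smul_integral_compactWall` in place of (C-bdry-ρ).  In the
assembly of (M2-01) every partner `ρ` of the Cayley-frame `H`-family falls under one of the two files: its `w`-wall is noncompact (three limits `Jp, Jm, D`, mirror pairs cancel
the jump) or compact (this file: no jump at all, `G → 0` from both sides, `G′ → D`).

SETTING (★ (δ)∕(C-bdry-glob) verbatim).  `G′_∞ = U(diag α)(L⁺ ⊗ ℝ) ≃ₜ* Π_v G_v` (★ `archPiEquivCM`), per-place Haar measures `ν_v`, `ν_∞ = e⁻¹_*(⊗ ν_v)`; a place `w`; a global torus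
point `z` regular at every `v ≠ w` with `z w 0 = z w 2 ≠ z w 1`; the global one-angle curve `z^ψ = update z w (i ↦ z w i · e^{i(1,0,−1)_i ψ})`; a relabelling `ρ : W → S₃` whose `w`-wall
is COMPACT (`0 < re σ_w(α_{ρ_w⁻¹0})·re σ_w(α_{ρ_w⁻¹2})`); an ambient-smooth `Θ : M₃(L ⊗ ℝ) → ℂ` compactly supported on the group.

WHAT IS PROVED.
* `tendsto_two_sin_mul_integral_comp_conj_splitCurve_comp_perm_of_pos` — PER PLACE, relabelled partner `ρ`: `g_ρ(ψ) = 2 sin ψ · ∫_{G_w} Θ(↑↑(x·diag(z_ψ∘ρ)·x⁻¹)) dν → 0` as `ψ → 0`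
  (the torus orbital function is continuous through a compact wall, ★ (C-cw)) and `g_ρ′ → D` as `ψ → 0` for some `D` (★ (J-cw), `D = 2·F(z₀∘ρ)`), after J1's transport to the standard
  curve on `G_w(α∘ρ⁻¹)`;
* **`tendsto_two_sin_mul_integral_comp_conj_archDiagTorus_update_splitCurve_comp_of_pos`** — GLOBAL: `G(ψ) = 2 sin ψ · ∫_{G′_∞} Θ(↑↑(g·t((z^ψ)∘ρ)·g⁻¹)) dν_∞ → 0` and `G′ → D` along
  the punctured neighbourhood `ψ → 0, ψ ≠ 0` (where the global function IS the per-place one of the partial orbital lambda, ★ (δ) §2 + ★ `exists_contDiff_partialOrbital_eq`).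
HONEST LABEL: HC_CM is proved only modulo the 7 printed citations (2 remaining: hLiu418 = stmt-HodgeConjecture-24832, h413 = stmt-HodgeConjecture-24833) until rung 0 closes; kit for (M2-01),
pays nothing by itself.

## References
* [Rogawski1990] J. D. Rogawski, *Automorphic Representations of Unitary Groups in Three Variables*, Ann. of Math. Stud. 123 (1990), §8.2 pp. 119, 122–124.
* [Varadarajan1989] V. S. Varadarajan, *An Introduction to Harmonic Analysis on Semisimple Lie Groups* (1989), §6.4 Thm 18, Thm 20.
* [BorelJacquet1979] A. Borel, H. Jacquet, *Automorphic forms and automorphic representations*, PSPM 33.1 (1979), §4.1.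
-/

set_option autoImplicit false

noncomputable section

open MeasureTheory Measure Filter Topology NumberField NumberField.InfinitePlace NumberField.mixedEmbedding Equiv Function Set
open Literature.MeasureTheory.Group Literature.NumberTheory.Automorphic Literature.NumberTheory.Automorphic.UnitaryGroup
open Literature.LinearAlgebra.Matrix
open scoped Matrix MatrixGroups Matrix.Norms.Operator ContDiff

namespace Literature.NumberTheory.Rogawski1990

section Local

variable (L : Type) [Field L] (α : Fin 3 → L) (w : {w : InfinitePlace L // IsComplex w})
  [MeasurableSpace (GL (Fin 3) ℂ)] [BorelSpace (GL (Fin 3) ℂ)]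

/-- **PER PLACE, RELABELLED PARTNER `ρ`, COMPACT WALL**: `g_ρ(ψ) = 2 sin ψ · ∫_{G_w} Θ(↑↑(x·diag(z_ψ ∘ ρ)·x⁻¹)) dν` with `z₀ 0 = z₀ 2 ≠ z₀ 1` and `0 < re σ_w(α_{ρ⁻¹0})·re σ_w(α_{ρ⁻¹2})`
tends to `0` as `ψ → 0` (★ (C-cw): the orbital function is continuous through the compact wall) and `g_ρ′` has a limit `D` as `ψ → 0` (★ (J-cw), `D = 2·F(z₀ ∘ ρ)`).
[cite: Rogawski1990, §8.2 p. 123] [cite: Varadarajan1989, §6.4 Thm 18] -/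
theorem tendsto_two_sin_mul_integral_comp_conj_splitCurve_comp_perm_of_pos (hα : ∀ i, α i ≠ 0) (hreal : ∀ i, (w.1.embedding (α i)).im = 0)
    (ν : Measure (archLocal L 3 (Matrix.diagonal α) w)) [ν.IsHaarMeasure]
    (Θ : Matrix (Fin 3) (Fin 3) ℂ → ℂ) (hΘ : ContDiff ℝ (⊤ : ℕ∞) Θ)
    (hΘc : HasCompactSupport fun k : archLocal L 3 (Matrix.diagonal α) w => Θ (((k : GL (Fin 3) ℂ) : Matrix (Fin 3) (Fin 3) ℂ)))
    (z₀ : Fin 3 → Circle) (h02 : z₀ 0 = z₀ 2) (h01 : z₀ 0 ≠ z₀ 1) (ρ : Perm (Fin 3))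
    (hpos : 0 < (w.1.embedding (α (ρ⁻¹ 0))).re * (w.1.embedding (α (ρ⁻¹ 2))).re) :
    Tendsto (fun ψ : ℝ => (2 * Real.sin ψ : ℂ) * ∫ g : archLocal L 3 (Matrix.diagonal α) w,
        Θ ((((g * ⟨circleDiagonal 3 ((fun i => z₀ i * Circle.exp (![(1 : ℝ), 0, -1] i * ψ)) ∘ ⇑ρ), circleDiagonal_mem_archLocal_diagonal L 3 α w _⟩ * g⁻¹ :
          archLocal L 3 (Matrix.diagonal α) w) : GL (Fin 3) ℂ) : Matrix (Fin 3) (Fin 3) ℂ)) ∂ν) (𝓝 0) (𝓝 0) ∧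
    ∃ D : ℂ, Tendsto (fun ψ : ℝ => deriv (fun ψ : ℝ => (2 * Real.sin ψ : ℂ) * ∫ g : archLocal L 3 (Matrix.diagonal α) w,
        Θ ((((g * ⟨circleDiagonal 3 ((fun i => z₀ i * Circle.exp (![(1 : ℝ), 0, -1] i * ψ)) ∘ ⇑ρ), circleDiagonal_mem_archLocal_diagonal L 3 α w _⟩ * g⁻¹ :
          archLocal L 3 (Matrix.diagonal α) w) : GL (Fin 3) ℂ) : Matrix (Fin 3) (Fin 3) ℂ)) ∂ν) ψ) (𝓝 0) (𝓝 D) := by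
  classical
  -- transport to the standard curve on the relabelled group `G_w(α ∘ ρ⁻¹)` (★ J1)
  rw [sin_mul_integral_comp_conj_splitCurve_comp_perm_eq L α w ν Θ z₀ ρ]
  have hα' : ∀ i, (α ∘ ⇑ρ⁻¹) i ≠ 0 := fun i => hα (ρ⁻¹ i)
  have hreal' : ∀ i, (w.1.embedding ((α ∘ ⇑ρ⁻¹) i)).im = 0 := fun i => hreal (ρ⁻¹ i)
  haveI : LocallyCompactSpace (archLocal L 3 (Matrix.diagonal (α ∘ ⇑ρ⁻¹)) w) := locallyCompactSpace_archLocal L 3 _ w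
  haveI : SecondCountableTopology (archLocal L 3 (Matrix.diagonal (α ∘ ⇑ρ⁻¹)) w) := secondCountableTopology_archLocal L 3 _ w
  set ν' : Measure (archLocal L 3 (Matrix.diagonal (α ∘ ⇑ρ⁻¹)) w) :=
    ν.map (ContinuousMulEquiv.restrictSubgroup (GLn.conjEquiv (Matrix.GeneralLinearGroup.mkOfDetNeZero _ (det_monomial_one_ne_zero 3 ρ⁻¹)))
      (archLocal L 3 (Matrix.diagonal (α ∘ ⇑ρ⁻¹)) w) (archLocal L 3 (Matrix.diagonal α) w) (mem_archLocal_comp_perm_iff_conj_mem L 3 α w ρ⁻¹)).symm with hν'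
  haveI : ν'.IsHaarMeasure := ContinuousMulEquiv.isHaarMeasure_map ν _
  set Θ' : Matrix (Fin 3) (Fin 3) ℂ → ℂ := fun A => Θ ((monomial ρ⁻¹ fun _ : Fin 3 => (1 : ℂ)) * A *
      (((Matrix.GeneralLinearGroup.mkOfDetNeZero _ (det_monomial_one_ne_zero 3 ρ⁻¹))⁻¹ : GL (Fin 3) ℂ) : Matrix (Fin 3) (Fin 3) ℂ)) with hΘ'
  have hΘ's : ContDiff ℝ (⊤ : ℕ∞) Θ' := contDiff_comp_monomial_conj 3 ρ⁻¹ Θ hΘ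
  have hΘ'1 : ContDiff ℝ 1 Θ' := hΘ's.of_le (by exact_mod_cast le_top)
  have hΘ'c : HasCompactSupport fun k : archLocal L 3 (Matrix.diagonal (α ∘ ⇑ρ⁻¹)) w => Θ' (((k : GL (Fin 3) ℂ) : Matrix (Fin 3) (Fin 3) ℂ)) :=
    hasCompactSupport_comp_relabel L 3 α w ρ⁻¹ Θ hΘc
  have h12 : z₀ 1 ≠ z₀ 2 := fun h => h01 (h02.trans h.symm)
  refine ⟨?_, ?_⟩
  · -- ★ (C-cw): the orbital function is continuous through the compact wall, so `2 sin ψ · O(ψ) → 2 sin 0 · O(0) = 0`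
    have hf : Continuous fun k : archLocal L 3 (Matrix.diagonal (α ∘ ⇑ρ⁻¹)) w => Θ' (((k : GL (Fin 3) ℂ) : Matrix (Fin 3) (Fin 3) ℂ)) :=
      hΘ's.continuous.comp (Units.continuous_val.comp continuous_subtype_val)
    have hO := (continuousAt_integral_comp_conj_circleDiagonal_compactWall L (α ∘ ⇑ρ⁻¹) w hα' hreal' hpos ν' _ hf hΘ'c h01 h12).tendsto.comp
      ((continuous_torusCurve z₀ ![(1 : ℝ), 0, -1]).tendsto' 0 z₀ (by funext i; simp))
    have hsin : Tendsto (fun ψ : ℝ => (2 * Real.sin ψ : ℂ)) (𝓝 0) (𝓝 0) := by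
      have h := ((Complex.continuous_ofReal.comp Real.continuous_sin).const_mul (2 : ℂ)).tendsto 0
      simpa using h
    have h := hsin.mul hO
    rw [zero_mul] at h
    exact h
  · -- ★ (J-cw): `g′ → 2·F(z₀)` on the relabelled group
    have hcw := tendsto_deriv_sin_smul_integral_compactWall L (α ∘ ⇑ρ⁻¹) w ν' hα' hreal' hpos Θ' hΘ'1 hΘ'c h01 h12
    simp only [Complex.real_smul, Complex.ofReal_mul, Complex.ofReal_ofNat] at hcw
    exact ⟨_, hcw⟩

end Local

section Global

variable (L : Type) [Field L] [NumberField L] [IsCMField L] (α : Fin 3 → L) (w : {w : InfinitePlace L // IsComplex w})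
  [MeasurableSpace (GL (Fin 3) ℂ)] [BorelSpace (GL (Fin 3) ℂ)]
  [MeasurableSpace (arch (↥(maximalRealSubfield L)) L (IsCMField.complexConj L) 3 (Matrix.diagonal α))] [BorelSpace (arch (↥(maximalRealSubfield L)) L (IsCMField.complexConj L) 3 (Matrix.diagonal α))]

open scoped Classical in
/-- **GLOBAL, COMPACT WALL OF ONE INDEFINITE PLACE**: in the setting above, with the `w`-wall of `ρ` compact (`0 < re σ_w(α_{ρ_w⁻¹0})·re σ_w(α_{ρ_w⁻¹2})`),
`G(ψ) = 2 sin ψ · ∫_{G′_∞} Θ(↑↑(g·t((z^ψ)∘ρ)·g⁻¹)) dν_∞ → 0` and `G′ → D` (some `D : ℂ`) as `ψ → 0`, `ψ ≠ 0`: NO jump and NO kink at a compact wall.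
[cite: Rogawski1990, §8.2 p. 123] [cite: Varadarajan1989, §6.4 Thm 18] [cite: BorelJacquet1979, §4.1] -/
theorem tendsto_two_sin_mul_integral_comp_conj_archDiagTorus_update_splitCurve_comp_of_pos
    (νw : ∀ v : {w : InfinitePlace L // IsComplex w}, Measure (archLocal L 3 (Matrix.diagonal α) v)) [∀ v, (νw v).IsHaarMeasure]
    (hα : ∀ i, α i ≠ 0) (hherm : ∀ i, (IsCMField.complexConj L (α i) : L) = α i)
    (Θ : Matrix (Fin 3) (Fin 3) (mixedSpace L) → ℂ) (hΘ : ContDiff ℝ (⊤ : ℕ∞) Θ)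
    (hΘc : HasCompactSupport fun g : arch (↥(maximalRealSubfield L)) L (IsCMField.complexConj L) 3 (Matrix.diagonal α) => Θ ((g : GL (Fin 3) (mixedSpace L)) : Matrix (Fin 3) (Fin 3) (mixedSpace L)))
    (z : {w : InfinitePlace L // IsComplex w} → Fin 3 → Circle) (hz : ∀ v, v ≠ w → Function.Injective (z v)) (h02 : z w 0 = z w 2) (h01 : z w 0 ≠ z w 1)
    (ρ : {w : InfinitePlace L // IsComplex w} → Perm (Fin 3))
    (hpos : 0 < (w.1.embedding (α ((ρ w)⁻¹ 0))).re * (w.1.embedding (α ((ρ w)⁻¹ 2))).re) :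
    Tendsto (fun ψ : ℝ => (2 * Real.sin ψ : ℂ) *
        ∫ g, Θ (((g * archDiagTorus L 3 α (fun v => Function.update z w (fun i => z w i * Circle.exp (![(1 : ℝ), 0, -1] i * ψ)) v ∘ ⇑(ρ v)) * g⁻¹ :
          arch (↥(maximalRealSubfield L)) L (IsCMField.complexConj L) 3 (Matrix.diagonal α)) : GL (Fin 3) (mixedSpace L)) : Matrix (Fin 3) (Fin 3) (mixedSpace L))
          ∂((Measure.pi νw).map (archPiEquivCM 3 L (Matrix.diagonal α)).symm)) (𝓝[≠] 0) (𝓝 0) ∧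
    ∃ D : ℂ, Tendsto (fun ψ : ℝ => deriv (fun ψ : ℝ => (2 * Real.sin ψ : ℂ) *
        ∫ g, Θ (((g * archDiagTorus L 3 α (fun v => Function.update z w (fun i => z w i * Circle.exp (![(1 : ℝ), 0, -1] i * ψ)) v ∘ ⇑(ρ v)) * g⁻¹ :
          arch (↥(maximalRealSubfield L)) L (IsCMField.complexConj L) 3 (Matrix.diagonal α)) : GL (Fin 3) (mixedSpace L)) : Matrix (Fin 3) (Fin 3) (mixedSpace L))
          ∂((Measure.pi νw).map (archPiEquivCM 3 L (Matrix.diagonal α)).symm)) ψ) (𝓝[≠] 0) (𝓝 D) := by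
  have hreal : ∀ i, (w.1.embedding (α i)).im = 0 := fun i => im_embedding_eq_zero_of_complexConj_eq L w (hherm i)
  haveI : ∀ v : {w : InfinitePlace L // IsComplex w}, LocallyCompactSpace (archLocal L 3 (Matrix.diagonal α) v) := fun v => locallyCompactSpace_archLocal L 3 (Matrix.diagonal α) v
  haveI : ∀ v : {w : InfinitePlace L // IsComplex w}, SecondCountableTopology (archLocal L 3 (Matrix.diagonal α) v) := fun v => secondCountableTopology_archLocal L 3 (Matrix.diagonal α) v
  -- the partial orbital lambda over the places `v ≠ w` at the relabelled base `(z_v ∘ ρ_v)_v` is an ambient-smooth test function `Θ′` on `G_w`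
  obtain ⟨Θ', hΘ', hΘ'c, hΘ'eq⟩ := exists_contDiff_partialOrbital_eq L 3 α νw hα w Θ hΘ hΘc (z := fun v => z v ∘ ⇑(ρ v))
    (fun v hv => (hz v hv).comp (ρ v).injective)
  -- the per-place function at `w`: `→ 0` and `deriv → D` (this file, per place)
  obtain ⟨h0, D, hD⟩ := tendsto_two_sin_mul_integral_comp_conj_splitCurve_comp_perm_of_pos L α w hα hreal (νw w) Θ' hΘ' hΘ'c (z w) h02 h01 (ρ w) hpos
  -- the open set of regular parameters at `w`, a punctured neighbourhood of `0`
  set T : Set ℝ := {ψ | Function.Injective fun i => z w i * Circle.exp (![(1 : ℝ), 0, -1] i * ψ)} with hT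
  have hTopen : IsOpen T := isOpen_setOf_injective.preimage (continuous_torusCurve (z w) ![(1 : ℝ), 0, -1])
  have hTev : ∀ᶠ ψ in 𝓝[≠] (0 : ℝ), ψ ∈ T := eventually_injective_splitCurve (z w) h02 h01
  -- on `T` the global function IS the per-place one
  have heq : ∀ ψ ∈ T, (2 * Real.sin ψ : ℂ) *
      ∫ g, Θ (((g * archDiagTorus L 3 α (fun v => Function.update z w (fun i => z w i * Circle.exp (![(1 : ℝ), 0, -1] i * ψ)) v ∘ ⇑(ρ v)) * g⁻¹ :
        arch (↥(maximalRealSubfield L)) L (IsCMField.complexConj L) 3 (Matrix.diagonal α)) : GL (Fin 3) (mixedSpace L)) : Matrix (Fin 3) (Fin 3) (mixedSpace L))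
        ∂((Measure.pi νw).map (archPiEquivCM 3 L (Matrix.diagonal α)).symm) =
      (2 * Real.sin ψ : ℂ) * ∫ g : archLocal L 3 (Matrix.diagonal α) w,
        Θ' ((((g * ⟨circleDiagonal 3 ((fun i => z w i * Circle.exp (![(1 : ℝ), 0, -1] i * ψ)) ∘ ⇑(ρ w)), circleDiagonal_mem_archLocal_diagonal L 3 α w _⟩ * g⁻¹ :
          archLocal L 3 (Matrix.diagonal α) w) : GL (Fin 3) ℂ) : Matrix (Fin 3) (Fin 3) ℂ)) ∂(νw w) := by
    intro ψ hψ
    have hreg : ∀ v, Function.Injective (Function.update z w (fun i => z w i * Circle.exp (![(1 : ℝ), 0, -1] i * ψ)) v ∘ ⇑(ρ v)) := by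
      intro v
      by_cases hv : v = w
      · subst hv; rw [Function.update_self]; exact (show Function.Injective _ from hψ).comp (ρ v).injective
      · rw [Function.update_of_ne hv]; exact (hz v hv).comp (ρ v).injective
    rw [integral_comp_conj_archDiagTorus_update_comp_eq_integral_partial L α w νw hα Θ hΘ.continuous hΘc z _ ρ hreg]
    congr 1
    refine integral_congr_ae (Eventually.of_forall fun x => ?_)
    exact (hΘ'eq _).symm
  have hEv : ∀ᶠ ψ in 𝓝[≠] (0 : ℝ), (2 * Real.sin ψ : ℂ) *
      ∫ g, Θ (((g * archDiagTorus L 3 α (fun v => Function.update z w (fun i => z w i * Circle.exp (![(1 : ℝ), 0, -1] i * ψ)) v ∘ ⇑(ρ v)) * g⁻¹ :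
        arch (↥(maximalRealSubfield L)) L (IsCMField.complexConj L) 3 (Matrix.diagonal α)) : GL (Fin 3) (mixedSpace L)) : Matrix (Fin 3) (Fin 3) (mixedSpace L))
        ∂((Measure.pi νw).map (archPiEquivCM 3 L (Matrix.diagonal α)).symm) =
      (2 * Real.sin ψ : ℂ) * ∫ g : archLocal L 3 (Matrix.diagonal α) w,
        Θ' ((((g * ⟨circleDiagonal 3 ((fun i => z w i * Circle.exp (![(1 : ℝ), 0, -1] i * ψ)) ∘ ⇑(ρ w)), circleDiagonal_mem_archLocal_diagonal L 3 α w _⟩ * g⁻¹ :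
          archLocal L 3 (Matrix.diagonal α) w) : GL (Fin 3) ℂ) : Matrix (Fin 3) (Fin 3) ℂ)) ∂(νw w) := hTev.mono heq
  -- the derivatives agree on the open set `T`
  have hDev : ∀ᶠ ψ in 𝓝[≠] (0 : ℝ), deriv (fun ψ : ℝ => (2 * Real.sin ψ : ℂ) *
      ∫ g, Θ (((g * archDiagTorus L 3 α (fun v => Function.update z w (fun i => z w i * Circle.exp (![(1 : ℝ), 0, -1] i * ψ)) v ∘ ⇑(ρ v)) * g⁻¹ :
        arch (↥(maximalRealSubfield L)) L (IsCMField.complexConj L) 3 (Matrix.diagonal α)) : GL (Fin 3) (mixedSpace L)) : Matrix (Fin 3) (Fin 3) (mixedSpace L))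
        ∂((Measure.pi νw).map (archPiEquivCM 3 L (Matrix.diagonal α)).symm)) ψ =
      deriv (fun ψ : ℝ => (2 * Real.sin ψ : ℂ) * ∫ g : archLocal L 3 (Matrix.diagonal α) w,
        Θ' ((((g * ⟨circleDiagonal 3 ((fun i => z w i * Circle.exp (![(1 : ℝ), 0, -1] i * ψ)) ∘ ⇑(ρ w)), circleDiagonal_mem_archLocal_diagonal L 3 α w _⟩ * g⁻¹ :
          archLocal L 3 (Matrix.diagonal α) w) : GL (Fin 3) ℂ) : Matrix (Fin 3) (Fin 3) ℂ)) ∂(νw w)) ψ := by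
    refine hTev.mono fun ψ hψ => Filter.EventuallyEq.deriv_eq ?_
    exact Filter.eventually_of_mem (hTopen.mem_nhds hψ) fun ψ' hψ' => heq ψ' hψ'
  exact ⟨(tendsto_nhdsWithin_of_tendsto_nhds h0).congr' (hEv.mono fun _ h => h.symm), D, (tendsto_nhdsWithin_of_tendsto_nhds hD).congr' (hDev.mono fun _ h => h.symm)⟩

end Global

end Literature.NumberTheory.Rogawski1990

end
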